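import Summits.ValiantsHypothesis.ValiantsHypothesis.Theorems.BarrierLeverAnchoredDoorHitsLowerPairsUQFaceSpec

/-!
# Support item `AnchoredDoorHitsLowerPairs` (stmt-ValiantsHypothesis-22510), line `anchored-peeling`:
# the weighted specialisation for anchors whose target faces CONTAIN a common face (UQ², pair-distinct private anchors)

Helper file (`--supports stmt-ValiantsHypothesis-22510`; cell valiant-natproofs, rung V4, 𝒟-side door (c); registered line
`Cruxes/AnchoredDoorHitsLowerPairs/Lines/anchored_peeling.lean` v14; prover seat val-np-p1 gen 20). Closes NO item.

`…UQFaceSpec` (p625046) proved the entry formula of the weighted one-variable specialisation `wSpecHom` for a set `𝔅` of anchors that all have the SAME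
target face `F`. The only use of `α.2 = F` was «two anchors of `𝔅` cannot be read in one square-free monomial». That already holds when every target
face merely CONTAINS the common nonempty face `F` (they all carry `y_F`). This file re-proves the entry formula and its three consequences under the weaker
hypothesis `∀ α ∈ 𝔅, F ⊆ α.2` (`prod_map_wSpecHom_symbFactor'`, `coeff_map_wSpecHom_symbolicWitness'`, `wSpecHom_coeff_eq_C'`,
`natDegree_wSpecHom_coeff_le'`, `coeff_wSpecHom_coeff_top'`). Consequence (sequel `…UQFaceCoreTwo`): in the face-target UQ step the `m` private anchors
`(ρ_A | F_A)` need only be pairwise distinct AS PAIRS, with roots `ρ_A ⊆ A` and sub-targets `W₀ ⊆ F_A ⊆ B_A` of size `≤ s` — not distinct roots.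

WHAT THIS IS NOT: no determinant statement; nothing on crux stmt-ValiantsHypothesis-14610 or on `VP` versus `VNP`.
-/

set_option linter.dupNamespace false

namespace Summit.ValiantsHypothesis.ValiantsHypothesis.Theorems.BarrierLever.AnchoredPeeling

open Finset MvPolynomial
open Summit.ValiantsHypothesis.ValiantsHypothesis.Theorems.BarrierLever.BrickCalculus (pexpo pexpo_def pexpo_le_iff pexpo_sub
  pexpo_apply_natAdd pexpo_apply_castAdd)

noncomputable section

variable {h : ℕ}

/-- The product of the specialised factors of a set of anchors whose target faces all CONTAIN `F`: no mixed terms modulo `y_F²`. -/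
theorem prod_map_wSpecHom_symbFactor' {𝔅 : Finset (Finset (Fin h) × Finset (Fin h))} {F : Finset (Fin h)} (h2 : ∀ α ∈ 𝔅, F ⊆ α.2)
    {P Q : Finset (Fin h) × Finset (Fin h) → Finset (Fin h)} (hP : ∀ α ∈ 𝔅, P α ⊆ univ \ α.1) (hQ : ∀ α ∈ 𝔅, Q α ⊆ univ \ α.2)
    (wt : Finset (Fin h) × Finset (Fin h) → ℕ) :
    ∃ Rm : MvPolynomial (Fin (h + h)) (Polynomial (MvPolynomial (Param h) ℂ)),
      (∏ α ∈ 𝔅, MvPolynomial.map (wSpecHom 𝔅 P Q wt) (symbFactor h α)) =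
        1 + (∑ α ∈ 𝔅, ∑ Z ∈ (P α).powerset, ∑ W ∈ (Q α).powerset,
              C (Polynomial.X ^ (wt α * (Z.card + W.card + 1))) * monomial (pexpo (α.1 ∪ Z) (α.2 ∪ W)) 1) +
          monomial (pexpo (∅ : Finset (Fin h)) F + pexpo (∅ : Finset (Fin h)) F) 1 * Rm := by
  classical
  -- the specialised factors are `1 + y^F · Y' α`
  let Y' : Finset (Fin h) × Finset (Fin h) → MvPolynomial (Fin (h + h)) (Polynomial (MvPolynomial (Param h) ℂ)) := fun α =>
    ∑ Z ∈ (P α).powerset, ∑ W ∈ (Q α).powerset,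
      C (Polynomial.X ^ (wt α * (Z.card + W.card + 1))) * monomial (pexpo (α.1 ∪ Z) ((α.2 \ F) ∪ W)) 1
  have hmm : ∀ e : Fin (h + h) →₀ ℕ,
      (monomial (pexpo (∅ : Finset (Fin h)) F) (1 : Polynomial (MvPolynomial (Param h) ℂ)) * monomial e 1 :
          MvPolynomial (Fin (h + h)) (Polynomial (MvPolynomial (Param h) ℂ))) =
        monomial (pexpo (∅ : Finset (Fin h)) F + e) 1 := fun e => by
    rw [monomial_mul, one_mul]
  have hsplit : ∀ α ∈ 𝔅, ∀ Z W : Finset (Fin h), Disjoint α.2 W →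
      pexpo (α.1 ∪ Z) (α.2 ∪ W) = pexpo (∅ : Finset (Fin h)) F + pexpo (α.1 ∪ Z) ((α.2 \ F) ∪ W) := by
    intro α hα Z W hdW
    have hFW : Disjoint F ((α.2 \ F) ∪ W) := by
      rw [Finset.disjoint_union_right]
      exact ⟨Finset.disjoint_sdiff, Finset.disjoint_of_subset_left (h2 α hα) hdW⟩
    have := pexpo_union (A := (∅ : Finset (Fin h))) (Z := α.1 ∪ Z) (B := F) (W := (α.2 \ F) ∪ W) (Finset.disjoint_empty_left _) hFW
    rw [Finset.empty_union, ← Finset.union_assoc, Finset.union_sdiff_of_subset (h2 α hα)] at this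
    exact this
  have hYY' : ∀ α ∈ 𝔅,
      (∑ Z ∈ (P α).powerset, ∑ W ∈ (Q α).powerset,
          C (Polynomial.X ^ (wt α * (Z.card + W.card + 1))) * monomial (pexpo (α.1 ∪ Z) (α.2 ∪ W)) 1 :
            MvPolynomial (Fin (h + h)) (Polynomial (MvPolynomial (Param h) ℂ))) =
        monomial (pexpo (∅ : Finset (Fin h)) F) 1 * Y' α := by
    intro α hα
    simp only [Y', Finset.mul_sum]
    refine Finset.sum_congr rfl (fun Z _ => Finset.sum_congr rfl (fun W hW => ?_))
    have hdW : Disjoint α.2 W :=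
      Finset.disjoint_of_subset_right (Finset.mem_powerset.mp hW) (Finset.disjoint_of_subset_right (hQ α hα) Finset.disjoint_sdiff)
    rw [hsplit α hα Z W hdW, ← hmm, mul_left_comm]
  have hfac : ∀ α ∈ 𝔅, MvPolynomial.map (wSpecHom 𝔅 P Q wt) (symbFactor h α) = 1 + monomial (pexpo (∅ : Finset (Fin h)) F) 1 * Y' α := by
    intro α hα
    rw [map_wSpecHom_symbFactor_of_mem 𝔅 P Q wt hα (hP α hα) (hQ α hα), hYY' α hα]
  obtain ⟨Rm, hRm⟩ := prod_one_add_monomial_mul 𝔅 (pexpo (∅ : Finset (Fin h)) F) Y'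
  refine ⟨Rm, ?_⟩
  rw [Finset.prod_congr rfl hfac, hRm]
  congr 2
  exact Finset.sum_congr rfl (fun α hα => (hYY' α hα).symm)

/-- **Entry formula for a set of anchors whose target faces contain a common nonempty face.** If every `α ∈ 𝔅 ⊆ anchors` has `F ⊆ α.2`, `F ≠ ∅`, then
`[x^S y^T] wSpec(symbolicWitness) = C L°[S,T] + Σ_{α ∈ 𝔅} Σ_{Z ⊆ P α, W ⊆ Q α} [α.1 ∪ Z ⊆ S ∧ α.2 ∪ W ⊆ T] · T^{wt α (|Z|+|W|+1)} · L°[S ∖ (α.1 ∪ Z), T ∖ (α.2 ∪ W)]`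
(no mixed terms: two anchors of `𝔅` would need `y_F²`). -/
theorem coeff_map_wSpecHom_symbolicWitness' (s h : ℕ) {𝔅 : Finset (Finset (Fin h) × Finset (Fin h))} (h𝔅 : 𝔅 ⊆ anchors s h)
    {F : Finset (Fin h)} (hF : F.Nonempty) (h2 : ∀ α ∈ 𝔅, F ⊆ α.2)
    {P Q : Finset (Fin h) × Finset (Fin h) → Finset (Fin h)} (hP : ∀ α ∈ 𝔅, P α ⊆ univ \ α.1) (hQ : ∀ α ∈ 𝔅, Q α ⊆ univ \ α.2)
    (wt : Finset (Fin h) × Finset (Fin h) → ℕ) (S T : Finset (Fin h)) :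
    coeff (pexpo S T) (MvPolynomial.map (wSpecHom 𝔅 P Q wt) (symbolicWitness s h)) =
      Polynomial.C (restSetEntry s h 𝔅 S T) +
        ∑ α ∈ 𝔅, ∑ Z ∈ (P α).powerset, ∑ W ∈ (Q α).powerset,
          (if α.1 ∪ Z ⊆ S ∧ α.2 ∪ W ⊆ T then
            Polynomial.monomial (wt α * (Z.card + W.card + 1)) (restSetEntry s h 𝔅 (S \ (α.1 ∪ Z)) (T \ (α.2 ∪ W)))
          else 0) := by
  classical
  simp only [restSetEntry]
  obtain ⟨Rm, hprod⟩ := prod_map_wSpecHom_symbFactor' h2 hP hQ wt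
  have hmixed : coeff (pexpo S T) (monomial (pexpo (∅ : Finset (Fin h)) F + pexpo (∅ : Finset (Fin h)) F) 1 * Rm *
      MvPolynomial.map Polynomial.C (symbRestSet s h 𝔅)) = 0 := by
    rw [mul_assoc]; exact coeff_pexpo_monomial_two_mul hF _ S T
  rw [map_wSpecHom_symbolicWitness s h h𝔅 P Q wt, hprod, add_mul, add_mul, one_mul, coeff_add, coeff_add, hmixed, add_zero,
    coeff_map, add_right_inj]
  rw [Finset.sum_mul, coeff_sum]
  refine Finset.sum_congr rfl (fun α _ => ?_)
  rw [Finset.sum_mul, coeff_sum]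
  refine Finset.sum_congr rfl (fun Z _ => ?_)
  rw [Finset.sum_mul, coeff_sum]
  refine Finset.sum_congr rfl (fun W _ => ?_)
  rw [mul_assoc, coeff_C_mul, coeff_monomial_mul']
  by_cases hle : α.1 ∪ Z ⊆ S ∧ α.2 ∪ W ⊆ T
  · rw [if_pos ((pexpo_le_iff _ _ _ _).mpr hle), if_pos hle, one_mul, pexpo_sub _ _ _ _ hle.1 hle.2, coeff_map,
      mul_comm, Polynomial.C_mul_X_pow_eq_monomial]
  · rw [if_neg (fun h' => hle ((pexpo_le_iff _ _ _ _).mp h')), if_neg hle, mul_zero]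

/-! ## 5. Consequences for single entries -/

section Entry2

variable {s : ℕ} {𝔅 : Finset (Finset (Fin h) × Finset (Fin h))} {F : Finset (Fin h)}
  {P Q : Finset (Fin h) × Finset (Fin h) → Finset (Fin h)} {wt : Finset (Fin h) × Finset (Fin h) → ℕ}

/-- Off the target face the specialised entry is the constant original entry. -/
theorem wSpecHom_coeff_eq_C' (h𝔅 : 𝔅 ⊆ anchors s h) (hF : F.Nonempty) (h2 : ∀ α ∈ 𝔅, F ⊆ α.2)
    (hP : ∀ α ∈ 𝔅, P α ⊆ univ \ α.1) (hQ : ∀ α ∈ 𝔅, Q α ⊆ univ \ α.2) (S T : Finset (Fin h)) (hT : ¬ F ⊆ T) :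
    wSpecHom 𝔅 P Q wt (coeff (pexpo S T) (symbolicWitness s h)) = Polynomial.C (coeff (pexpo S T) (symbolicWitness s h)) := by
  have hnot : ∀ α ∈ 𝔅, ¬ (α.1 ⊆ S ∧ α.2 ⊆ T) := fun α hα hsub => hT ((h2 α hα).trans hsub.2)
  rw [← MvPolynomial.coeff_map, coeff_map_wSpecHom_symbolicWitness' s h h𝔅 hF h2 hP hQ wt S T,
    coeff_symbolicWitness_eq_restSet s h h𝔅 S T hnot, Finset.sum_eq_zero (fun α hα => ?_), add_zero]
  refine Finset.sum_eq_zero (fun Z _ => Finset.sum_eq_zero (fun W _ => ?_))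
  rw [if_neg]
  exact fun hZW => hnot α hα ⟨Finset.union_subset_left hZW.1, Finset.union_subset_left hZW.2⟩

/-- Degree bound of a specialised entry: a bound `B` valid for every anchor of `𝔅` that fits into `(S, T)` with some twist sets. -/
theorem natDegree_wSpecHom_coeff_le' (h𝔅 : 𝔅 ⊆ anchors s h) (hF : F.Nonempty) (h2 : ∀ α ∈ 𝔅, F ⊆ α.2)
    (hP : ∀ α ∈ 𝔅, P α ⊆ univ \ α.1) (hQ : ∀ α ∈ 𝔅, Q α ⊆ univ \ α.2) (S T : Finset (Fin h)) (B : ℕ)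
    (hB : ∀ α ∈ 𝔅, ∀ Z ⊆ P α, ∀ W ⊆ Q α, α.1 ∪ Z ⊆ S → α.2 ∪ W ⊆ T → wt α * (Z.card + W.card + 1) ≤ B) :
    (wSpecHom 𝔅 P Q wt (coeff (pexpo S T) (symbolicWitness s h))).natDegree ≤ B := by
  classical
  rw [← MvPolynomial.coeff_map, coeff_map_wSpecHom_symbolicWitness' s h h𝔅 hF h2 hP hQ wt S T]
  exact natDegree_entry₃_le _ 𝔅 P Q (fun α Z W => α.1 ∪ Z ⊆ S ∧ α.2 ∪ W ⊆ T) (fun α Z W => wt α * (Z.card + W.card + 1))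
    (fun α Z W => restSetEntry s h 𝔅 (S \ (α.1 ∪ Z)) (T \ (α.2 ∪ W))) B
    (fun α hα Z hZ W hW hc => hB α hα Z (Finset.mem_powerset.mp hZ) W (Finset.mem_powerset.mp hW) hc.1 hc.2)

/-- **Top coefficient of a specialised entry, one designated anchor.** If `α₀ ∈ 𝔅` with full twist sets is the only fitting term of degree
`B = wt α₀ · (|P α₀| + |Q α₀| + 1) ≠ 0`, the coefficient at `B` is `[α₀.1 ∪ P α₀ ⊆ S ∧ α₀.2 ∪ Q α₀ ⊆ T] · L°[S ∖ (α₀.1 ∪ P α₀), T ∖ (α₀.2 ∪ Q α₀)]`. -/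
theorem coeff_wSpecHom_coeff_top' (h𝔅 : 𝔅 ⊆ anchors s h) (hF : F.Nonempty) (h2 : ∀ α ∈ 𝔅, F ⊆ α.2)
    (hP : ∀ α ∈ 𝔅, P α ⊆ univ \ α.1) (hQ : ∀ α ∈ 𝔅, Q α ⊆ univ \ α.2) (S T : Finset (Fin h)) {B : ℕ} (hB : B ≠ 0)
    {α₀ : Finset (Fin h) × Finset (Fin h)} (hα₀ : α₀ ∈ 𝔅) (hdeg₀ : wt α₀ * ((P α₀).card + (Q α₀).card + 1) = B)
    (honly : ∀ α ∈ 𝔅, ∀ Z ⊆ P α, ∀ W ⊆ Q α, α.1 ∪ Z ⊆ S → α.2 ∪ W ⊆ T → wt α * (Z.card + W.card + 1) = B →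
      α = α₀ ∧ Z = P α₀ ∧ W = Q α₀) :
    (wSpecHom 𝔅 P Q wt (coeff (pexpo S T) (symbolicWitness s h))).coeff B =
      if α₀.1 ∪ P α₀ ⊆ S ∧ α₀.2 ∪ Q α₀ ⊆ T then restSetEntry s h 𝔅 (S \ (α₀.1 ∪ P α₀)) (T \ (α₀.2 ∪ Q α₀)) else 0 := by
  classical
  rw [← MvPolynomial.coeff_map, coeff_map_wSpecHom_symbolicWitness' s h h𝔅 hF h2 hP hQ wt S T]
  exact coeff_entry₃_top _ 𝔅 P Q (fun α Z W => α.1 ∪ Z ⊆ S ∧ α.2 ∪ W ⊆ T) (fun α Z W => wt α * (Z.card + W.card + 1))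
    (fun α Z W => restSetEntry s h 𝔅 (S \ (α.1 ∪ Z)) (T \ (α.2 ∪ W))) hB hα₀ hdeg₀
    (fun α hα Z hZ W hW hc hd => honly α hα Z (Finset.mem_powerset.mp hZ) W (Finset.mem_powerset.mp hW) hc.1 hc.2 hd)

end Entry2

end

end Summit.ValiantsHypothesis.ValiantsHypothesis.Theorems.BarrierLever.AnchoredPeeling
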